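import Mathlib
import Summits.Ventures.HodgeRepro2.T6N42Defs
import Summits.Ventures.HodgeRepro2.T6N42Datum
import Summits.Ventures.HodgeRepro2.T6N42Hyp
import Summits.Ventures.HodgeRepro2.T6N42HypGQT
import Summits.Ventures.HodgeRepro2.T6N42Main

/-!
# T6N42Toy — sub-step N4.2: the non-vacuity witnesses (README §10.5(ii)(c)/(d))

The carriers of `T6N42Defs.lean` are inhabited and the displays of `T6N42Hyp.lean` hold jointly on
one model: the TOY dual pair (trivial groups, `ω` and `π` the trivial one-dimensional representations
on `ℂ`), the toy Witt tower built from it, and the toy type II datum with `(n, m) = (2, 3)`. On the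
toy every `Θ_{V_r}(π) ≠ 0` holds (the identity of `ℂ` is a non-zero equivariant map), so the first
occurrence index is `0`, Gan–Ichino Prop. 5.3(i) and Mínguez Thm. 1(2) hold, the toy zeta datum
(`Z^*(s)` = the product form on `ℂ × ℂ × ℂ`) satisfies GQT Prop. 35(i), and the three interface
Props of `N42Datum.FinitePlacesDatum` (irreducible smooth `π`, `n ≤ m`, the first lift) are
satisfied — `toyFinitePlaces` with `toyFinitePlaces_thetaNonzeroEverywhere` derived from `N42_main`
and `toyFinitePlaces_zetaNonzeroEverywhere` from `N42_zeta_main`.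
As a non-vacuity datum must, the toy witnesses the BINDERS, not the theorem: nothing here is a dual
pair in the sense of print.

README §8(d): uses an L-value-free non-vanishing device: NO (TIER5 §N4.2, a pre-02:16Z line of
record, continued).
-/

namespace Summit.Ventures.HodgeRepro2.T6.N42Toy

open Summit.Ventures.HodgeRepro2
open Summit.Ventures.HodgeRepro2.T6.N42Defs
open Summit.Ventures.HodgeRepro2.T6.N42Datum
open Summit.Ventures.HodgeRepro2.T6.N42Main
open Summit.Ventures.HodgeRepro2.T5DualPairSwap
open Summit.Ventures.HodgeRepro2.T5TrivialPartner

/-- The toy dual pair: `G(W) = H(V) = 1`, `ω` and `π` the trivial representations on `ℂ`. -/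
def toyPair : DualPairDatum where
  G := Unit
  H := Unit
  Ω := ℂ
  ω := Representation.trivial ℂ (Unit × Unit) ℂ
  Vπ := ℂ
  π := Representation.trivial ℂ Unit ℂ

/-- The identity of `ℂ` is a non-zero linear map. -/
theorem id_ne_zero : (LinearMap.id : ℂ →ₗ[ℂ] ℂ) ≠ 0 := fun h => by
  simpa using LinearMap.congr_fun h (1 : ℂ)

/-- On the toy pair, `Θ(π) ≠ 0`: the identity of `ℂ` intertwines the trivial actions. -/
theorem toyPair_thetaNonzero : toyPair.ThetaNonzero :=
  ⟨LinearMap.id, id_ne_zero, ⟨fun _ _ => rfl⟩⟩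

/-- The trivial representation of the trivial group on `ℂ` is irreducible. -/
theorem trivial_irreducible : (Representation.trivial ℂ Unit ℂ).IsIrreducible := by
  refine { toNontrivial := ⟨⟨⊥, ⊤, fun h => ?_⟩⟩, eq_bot_or_eq_top := fun W => ?_ }
  · exact (bot_ne_top : (⊥ : Submodule ℂ ℂ) ≠ ⊤) (congrArg Subrepresentation.toSubmodule h)
  · rcases IsSimpleOrder.eq_bot_or_eq_top (α := Submodule ℂ ℂ) W.toSubmodule with h | h
    · exact Or.inl (Subrepresentation.toSubmodule_injective h)
    · exact Or.inr (Subrepresentation.toSubmodule_injective h)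

/-- The trivial representation of the trivial group on `ℂ` is smooth (every stabiliser is the whole
group). -/
theorem trivial_smooth : LevelPositivity.IsSmooth (Representation.trivial ℂ Unit ℂ) := by
  intro v
  have h : ((LevelPositivity.stabilizer (Representation.trivial ℂ Unit ℂ) v : Subgroup Unit) :
      Set Unit) = Set.univ :=
    Set.eq_univ_of_forall fun g => by
      show (Representation.trivial ℂ Unit ℂ) g v = v
      simp [Representation.trivial]
  rw [h]
  exact isOpen_univ

/-- The toy pair's `π` is irreducible. -/
theorem toyPair_irreducible : toyPair.Irreducible := trivial_irreducible

/-- The toy pair's `π` is smooth. -/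
theorem toyPair_smooth : toyPair.Smooth := trivial_smooth

/-- The toy Witt tower: the toy pair at every level, `n = 0`. -/
def toyTower : TowerDatum where
  G := Unit
  n := 0
  H := fun _ => Unit
  Ω := fun _ => ℂ
  ω := fun _ => Representation.trivial ℂ (Unit × Unit) ℂ
  Vπ := ℂ
  π := Representation.trivial ℂ Unit ℂ

/-- On the toy tower `π` occurs at every level. -/
theorem toyTower_occurs (r : ℕ) : toyTower.Occurs r :=
  ⟨LinearMap.id, id_ne_zero, ⟨fun _ _ => rfl⟩⟩

/-- Gan–Ichino Prop. 5.3(i) holds on the toy tower. -/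
theorem toyTower_ganIchino : Hyp.GanIchino2014_Prop5_3_i toyTower :=
  fun _ _ _ _ r _ => toyTower_occurs r

/-- The toy tower's first occurrence index is `0`. -/
theorem toyTower_isFirstOccurrenceIndex_zero : toyTower.IsFirstOccurrenceIndex 0 :=
  isFirstOccurrenceIndex_zero toyTower (toyTower_occurs 0)

/-- The toy first lift: `ω₀` has the partner `(π, 1)` — the map `ℂ → ℂ ⊗ ℂ`, `x ↦ x ⊗ 1`. -/
theorem toyTower_firstLift :
    HasPartner (toyTower.ω 0) toyTower.π (charLinRep (1 : Unit →* ℂˣ)) := by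
  refine ⟨(TensorProduct.rid ℂ ℂ).symm.toLinearMap, fun h => ?_, ⟨fun g v => ?_⟩⟩
  · have h1 := LinearMap.congr_fun h (1 : ℂ)
    simp only [LinearEquiv.coe_coe] at h1
    exact one_ne_zero ((TensorProduct.rid ℂ ℂ).symm.map_eq_zero_iff.mp h1)
  · simp only [T5SplittingTwist.extTprod_apply]
    show (TensorProduct.rid ℂ ℂ).symm v =
      TensorProduct.map (Representation.trivial ℂ Unit ℂ g.1) (charLinRep (1 : Unit →* ℂˣ) g.2)
        ((TensorProduct.rid ℂ ℂ).symm v)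
    simp [Representation.trivial, charLinRep, TensorProduct.rid_symm_apply]

/-- The toy type II datum: `(n, m) = (2, 3)` on the toy pair. -/
def toyTypeII : TypeIIDatum where
  n := 2
  m := 3
  pair := toyPair

/-- Mínguez Thm. 1(2) holds on the toy type II datum. -/
theorem toyTypeII_minguez : Hyp.Minguez2008_Theoreme1_2 toyTypeII :=
  fun _ _ _ _ => toyPair_thetaNonzero

/-- The toy zeta datum on a dual pair datum whose `π` lives on `ℂ`: `R = π^∨ = ℂ` and
`Z^*(s)(r, d, v) = r · d · v` for every `s`. -/
def toyZeta (S : DualPairDatum) (e : S.Vπ ≃ₗ[ℂ] ℂ) : ZetaDatum S where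
  R := ℂ
  Vdual := ℂ
  Zstar := fun _ => (LinearMap.mul ℂ ℂ).compr₂ (LinearMap.smulRight LinearMap.id e.toLinearMap)

/-- The toy zeta datum evaluates as the product: `Z^*(s)(r, d, v) = r · d · e v`. -/
theorem toyZeta_apply (S : DualPairDatum) (e : S.Vπ ≃ₗ[ℂ] ℂ) (s r d : ℂ) (v : S.Vπ) :
    (toyZeta S e).Zstar s r d v = r * d * e v := by
  show ((LinearMap.mul ℂ ℂ).compr₂ (LinearMap.smulRight LinearMap.id e.toLinearMap)) r d v = _
  rw [LinearMap.compr₂_apply, LinearMap.smulRight_apply, LinearMap.mul_apply', LinearMap.id_apply,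
    LinearMap.smul_apply, smul_eq_mul, LinearEquiv.coe_coe]

/-- The toy zeta datum is non-zero at `½`: `Z^*(½)(1, 1, e⁻¹ 1) = 1`. -/
theorem toyZeta_nonzero (S : DualPairDatum) (e : S.Vπ ≃ₗ[ℂ] ℂ) : (toyZeta S e).Nonzero := by
  intro h
  have h1 : (toyZeta S e).Zstar (1 / 2) (1 : ℂ) (1 : ℂ) (e.symm 1) = 0 := by
    rw [h]; rfl
  rw [toyZeta_apply] at h1
  simp at h1

/-- GQT Prop. 35(i) holds on a toy pair with a non-zero theta lift and the toy zeta datum. -/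
theorem toyZeta_gqt (S : DualPairDatum) (e : S.Vπ ≃ₗ[ℂ] ℂ) (h : S.ThetaNonzero) :
    Hyp.GQT2014_Prop35_i S (toyZeta S e) :=
  ⟨fun _ => toyZeta_nonzero S e, fun _ => h⟩

/-- The toy finite-places datum: one split place and one non-split place, the toy zeta data. -/
def toyFinitePlaces : FinitePlacesDatum where
  SplitPlace := Unit
  NonsplitPlace := Unit
  splitDatum := fun _ => toyTypeII
  towerDatum := fun _ => toyTower
  β' := fun _ => 1
  zetaSplit := fun _ => toyZeta toyPair (LinearEquiv.refl ℂ ℂ)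
  zetaNonsplit := fun _ => toyZeta (toyTower.pair 1) (LinearEquiv.refl ℂ ℂ)

/-- The three interface Props and the two displays hold jointly on the toy finite-places datum, and
`N42_main` applies: `ThetaNonzeroEverywhere`. -/
theorem toyFinitePlaces_thetaNonzeroEverywhere : toyFinitePlaces.ThetaNonzeroEverywhere :=
  N42_main toyFinitePlaces
    ⟨fun _ => ⟨toyPair_irreducible, toyPair_smooth⟩, fun _ => ⟨trivial_irreducible, trivial_smooth⟩⟩
    (fun _ => Nat.zero_lt_succ 1) (fun _ => Nat.le_succ 2) (fun _ => toyTower_firstLift)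
    (fun _ => toyTypeII_minguez) (fun _ => toyTower_ganIchino)

/-- The zeta-integral form on the toy: `N42_zeta_main` applies (all displays, incl. the AC one,
and all interface Props hold jointly). -/
theorem toyFinitePlaces_zetaNonzeroEverywhere : toyFinitePlaces.ZetaNonzeroEverywhere :=
  N42_zeta_main toyFinitePlaces
    ⟨fun _ => ⟨toyPair_irreducible, toyPair_smooth⟩, fun _ => ⟨trivial_irreducible, trivial_smooth⟩⟩
    (fun _ => Nat.zero_lt_succ 1) (fun _ => Nat.le_succ 2) (fun _ => toyTower_firstLift)
    (fun _ => toyTypeII_minguez) (fun _ => toyTower_ganIchino)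
    (fun _ => toyZeta_gqt _ _ toyPair_thetaNonzero)
    (fun _ => toyZeta_gqt _ _ (toyTower_occurs 1))

/-- The finite-places datum type is inhabited (README §10.5(ii)(c)). -/
theorem finitePlacesDatum_nonempty : Nonempty FinitePlacesDatum := ⟨toyFinitePlaces⟩

end Summit.Ventures.HodgeRepro2.T6.N42Toy
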